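import Literature.NumberTheory.EllipticCurves.DeShalit1987.RayClassTower
import Literature.NumberTheory.GaloisRepresentations.ArtinReciprocityCharacterFiniteProofs
import Literature.NumberTheory.GaloisRepresentations.IntegralGaloisActionProofs
import Literature.NumberTheory.GaloisRepresentations.DecompositionGroupOfCompletion
import Literature.NumberTheory.GaloisRepresentations.GlobalArtinMapOfCharactersProofs
import Literature.NumberTheory.LFunctions.AbelianFrobeniusDensity
import Literature.NumberTheory.NumberFields.RayClassFieldIdelic
import Literature.NumberTheory.ComplexMultiplication.EllipticUnits.KatoUnitRepIndependence
import Summits.BirchSwinnertonDyer.BirchSwinnertonDyer.Theorems.PrintCf2RubinValueTwoLowerOfKatzValueExists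
import HarnessLib

/-!
# STUB-IDEAS k1 (gen 40) — «weaken / strengthen» on the A′ helpers of `stub_heegnerIndexLowerAtTwo`
# (crux `PrintCf2.SplitBadTwoLowerHalfOfFacts`, item 27851; road A′ = k2-g40 `IsCosetValues`, R223-H)

Stub-ideation sketch, NOT a Theorems file; nothing here proves BSD, the crux, or the stub.
Kernel content (0 `sorry`; axioms of every theorem = [propext, Classical.choice, Quot.sound]):

* §A  H2 of R223-H (`rayKer_le_ker`) in k2-g40's EXACT binder shape — a COROLLARY of the tree's
      strongest form `DeShalit1987.rayKer_le_ker_absRestrictNormalHom_rayClassField` (RayClassTower §2).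
* §B  H1 of R223-H (`exists_frobLift`) via its STRONGEST PROVABLE FORM: ONE absolute arithmetic
      Frobenius `σ_v ∈ Γ_K` restricts to `galFrob K L v` in EVERY finite abelian `L ⊆ K̄` unramified
      at `v` — so `γ₀ := σ_v ^ n` serves the whole tower `K(𝔣 v̄^m)`, `m ≥ 0`, at once (no compactness,
      no compatibility-of-Artin-symbols bookkeeping).
* §C  the Gauss DIGIT behind H4 in its WEAKEST SUFFICIENT (norm-only, phase-free) and abstract form:
      over any normed field with `‖2‖ = 1/2`, for `n ∈ {2, 3}`, a character `f` of `(ℤ/2ⁿ)ˣ` with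
      `f(1 + 2ⁿ⁻¹) = −1` and `ζ` with `ζ^{2^{n−1}} = −1`:
      `‖Σ_a f(a)⁻¹ ζ^{−a}‖ = 2^{−n/2}` (Mathlib only).
* §D  H3 of R223-H (`exists_unit`) in k2-g40's exact shape — one line from the fact II.2.4 (i).
* §E  the junction LOWER actually consumes, in its WEAKEST SUFFICIENT form: an UPPER bound
      `‖val‖ ≤ 2^{−M/2}` on one value of one Katz `G₂` at the frame point (one-sided twin of the
      tree's `lower_two_of_DGal_of_subsetForall_of_katzValueExists`).
* §F  JUNCTION (B74): k2-g40's three helper SIGNATURES `stubsig_exists_frobLift`,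
      `stubsig_rayKer_le_ker`, `stubsig_exists_unit` copied TOKEN-FOR-TOKEN from
      `Cruxes/…/STUB_IDEAS_stub_heegnerIndexLowerAtTwo_2_g40.lean` ll. 251–284 (a crux workfile is
      not importable — copied and said so) and each closed by ONE term of §B / §A / §D: R223-H's
      H1, H2, H3 are theorems.  H4 (`stubsig_norm_gaussSumInv_two`) is NOT closed here: §C is its
      digit; the card explains why H4 AS TYPED lacks the split / degree-one binder it needs.
-/

set_option autoImplicit false
set_option linter.dupNamespace false

noncomputable section

open scoped Classical NumberField
open NumberField IsDedekindDomain Field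
open Literature.NumberTheory.GaloisRepresentations
open Literature.NumberTheory.EllipticCurves
open Literature.NumberTheory.NumberFields (rayClassField isUnramifiedIn_rayClassField)
open Literature.NumberTheory.LFunctions.AbelianDensity (artinSymbol artinSymbol_finsuppProd)

namespace Summit.BirchSwinnertonDyer.BirchSwinnertonDyer.Cruxes.SplitBadTwoLowerHalfOfFacts.WeakStrongK1G40

/-! ## §A  H2 `rayKer_le_ker` — k2-g40's signature, from the tree's strongest form -/

section H2

variable {p : ℕ} [Fact p.Prime] {K : Type} [Field K] [NumberField K]

omit [Fact p.Prime] in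
/-- **H2 (R223-H) in k2-g40's exact binder shape.** If every prime dividing `𝔤 ≠ 0` lies in
`S ∪ {v, v̄}` with `v, v̄ ∣ p`, then `Gal(K̄/K(S^∞ p^∞)) = rayKer K p S` fixes the ray class field
`K(𝔤)`. Three lines from `DeShalit1987.rayKer_le_ker_absRestrictNormalHom_rayClassField`, whose
hypothesis `∀ w ∉ S, p ∉ w → ¬ 𝔤 ≤ w` is the STRONGEST form (no `v`, `v̄` named at all). -/
theorem rayKer_le_ker (S : Finset (HeightOneSpectrum (𝓞 K))) (v vbar : HeightOneSpectrum (𝓞 K))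
    (hv : ((p : ℕ) : 𝓞 K) ∈ v.asIdeal) (hvbar : ((p : ℕ) : 𝓞 K) ∈ vbar.asIdeal)
    (𝔤 : Ideal (𝓞 K)) (h𝔤 : 𝔤 ≠ ⊥)
    (hsupp : ∀ w : HeightOneSpectrum (𝓞 K), w.asIdeal ∣ 𝔤 → w ∈ S ∨ w = v ∨ w = vbar) :
    DeShalit1987.rayKer K p S ≤ (absRestrictNormalHom (rayClassField K 𝔤)).ker := by
  refine DeShalit1987.rayKer_le_ker_absRestrictNormalHom_rayClassField p S h𝔤 ?_
  intro w hwS hwp hle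
  rcases hsupp w (Ideal.dvd_iff_le.mpr hle) with h | h | h
  · exact hwS h
  · exact hwp (h ▸ hv)
  · exact hwp (h ▸ hvbar)

end H2

/-! ## §B  H1 `exists_frobLift` — via ONE absolute Frobenius (strongest provable form) -/

section H1

variable {K : Type} [Field K] [NumberField K]

/-- `F(𝔭ⁿ) = f(𝔭)ⁿ` for the Artin symbol of a prime power. [folklore] -/
theorem artinSymbol_asIdeal_pow {G : Type*} [CommGroup G] (f : HeightOneSpectrum (𝓞 K) → G)
    (v : HeightOneSpectrum (𝓞 K)) (n : ℕ) : artinSymbol f (v.asIdeal ^ n) = f v ^ n := by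
  have h := artinSymbol_finsuppProd f (Finsupp.single v n)
  simpa only [Finsupp.prod_single_index, pow_zero] using h

/-- **STRONGEST FORM of H1: one absolute Frobenius for all abelian levels at once.** For a finite
place `v` of `K` there is `σ ∈ Γ_K` (an arithmetic Frobenius at the prime `𝔓₀ ∣ v` of `ℤ̄_K` cut out
by `K̄ → K̄_v`) whose restriction to EVERY finite abelian `L ⊆ K̄` unramified at `v` is `galFrob K L v`
(Frobenius restricts to Frobenius; abelian ⇒ the Frobenius class is one element). -/
theorem exists_forall_absRestrictNormalHom_eq_galFrob (v : HeightOneSpectrum (𝓞 K)) :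
    ∃ σ : absoluteGaloisGroup K, ∀ (L : IntermediateField K (AlgebraicClosure K))
      [FiniteDimensional K L] [NumberField L] [IsAbelianGalois K L],
      Algebra.IsUnramifiedIn (𝓞 L) v.asIdeal → absRestrictNormalHom L σ = galFrob K L v := by
  have h𝔓 := adicCompletionPrime_mem_primesAbove K v
  obtain ⟨σ, hσ⟩ := HeightOneSpectrum.exists_isArithFrobAt_of_mem_primesAbove_holds h𝔓
  refine ⟨σ, fun L _ _ _ hunr ↦ ?_⟩
  haveI : (adicCompletionPrime K v).IsPrime := h𝔓.1
  exact eq_galFrob (fun a b ↦ IsMulCommutative.is_comm.comm a b) hunr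
    (comap_ringOfIntegersToIntegralClosure_mem_primesOver_of_mem_primesAbove L h𝔓)
    (isArithFrobAt_absRestrictNormalHom L hσ)

/-- `v ∤ 𝔣 v̄^m` when `(𝔣, v) = 1` and `v̄ ≠ v`. [folklore] -/
theorem not_mul_pow_le (𝔣 : Ideal (𝓞 K)) (v vbar : HeightOneSpectrum (𝓞 K))
    (hv : IsCoprime 𝔣 v.asIdeal) (hne : vbar ≠ v) (m : ℕ) :
    ¬ 𝔣 * vbar.asIdeal ^ m ≤ v.asIdeal := by
  intro hle
  rcases (Ideal.IsPrime.mul_le v.isPrime).mp hle with h | h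
  · have htop : 𝔣 ⊔ v.asIdeal = ⊤ := Ideal.isCoprime_iff_sup_eq.mp hv
    exact v.isPrime.ne_top (top_le_iff.mp (htop ▸ sup_le h le_rfl))
  · haveI := v.isPrime
    have h' : vbar.asIdeal ≤ v.asIdeal := Ideal.IsPrime.le_of_pow_le h
    exact hne (HeightOneSpectrum.ext (vbar.isMaximal.eq_of_le v.isPrime.ne_top h'))

/-- **H1 (R223-H) in k2-g40's exact shape**: a lift `γ₀ ∈ Γ_K` of the compatible Artin symbols
`(𝔭ⁿ, K(𝔣 v̄^m)/K)`, all `m ≥ 0` — namely `γ₀ = σ_v ^ n` for the absolute Frobenius of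
`exists_forall_absRestrictNormalHom_eq_galFrob` (`v` is unramified in every `K(𝔣 v̄^m)` since
`v ∤ 𝔣 v̄^m`, `isUnramifiedIn_rayClassField`). The binder `h𝔣` is used only for `𝔣 v̄^m ≠ 0`. -/
theorem exists_frobLift (𝔣 : Ideal (𝓞 K)) (h𝔣 : 𝔣 ≠ ⊥) (v vbar : HeightOneSpectrum (𝓞 K))
    (hv : IsCoprime 𝔣 v.asIdeal) (hne : vbar ≠ v) (n : ℕ) :
    ∃ γ₀ : absoluteGaloisGroup K, ∀ m : ℕ,
      absRestrictNormalHom (rayClassField K (𝔣 * vbar.asIdeal ^ m)) γ₀ =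
        artinSymbol (galFrob K (rayClassField K (𝔣 * vbar.asIdeal ^ m))) (v.asIdeal ^ n) := by
  obtain ⟨σ, hσ⟩ := exists_forall_absRestrictNormalHom_eq_galFrob (K := K) v
  refine ⟨σ ^ n, fun m ↦ ?_⟩
  have h𝔪 : 𝔣 * vbar.asIdeal ^ m ≠ ⊥ := mul_ne_zero h𝔣 (pow_ne_zero _ vbar.ne_bot)
  rw [map_pow, artinSymbol_asIdeal_pow,
    hσ (rayClassField K (𝔣 * vbar.asIdeal ^ m))
      (isUnramifiedIn_rayClassField h𝔪 (not_mul_pow_le 𝔣 v vbar hv hne m))]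

/-- The same lift serves SIMULTANEOUSLY every modulus `𝔪 ≠ 0` with `v ∤ 𝔪` (e.g. both towers
`K(𝔣 v̄^m)` and `K(𝔤 p^m)`-type levels prime to `v`): uniformity is free in the strongest form. -/
theorem exists_frobLift_uniform (v : HeightOneSpectrum (𝓞 K)) (n : ℕ) :
    ∃ γ₀ : absoluteGaloisGroup K, ∀ (𝔪 : Ideal (𝓞 K)), 𝔪 ≠ ⊥ → ¬ 𝔪 ≤ v.asIdeal →
      absRestrictNormalHom (rayClassField K 𝔪) γ₀ =
        artinSymbol (galFrob K (rayClassField K 𝔪)) (v.asIdeal ^ n) := by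
  obtain ⟨σ, hσ⟩ := exists_forall_absRestrictNormalHom_eq_galFrob (K := K) v
  refine ⟨σ ^ n, fun 𝔪 h𝔪 hv ↦ ?_⟩
  rw [map_pow, artinSymbol_asIdeal_pow, hσ (rayClassField K 𝔪) (isUnramifiedIn_rayClassField h𝔪 hv)]

end H1

/-! ## §C  The Gauss digit of H4 — weakest sufficient (norm-only) abstract form, `n ∈ {2, 3}` -/

section GaussDigit

variable {F : Type*} [NormedField F]

/-- `‖ζ‖ = 1` if `ζ^k = -1`, `k ≠ 0`. [folklore] -/
theorem norm_eq_one_of_pow_eq_neg_one {ζ : F} {k : ℕ} (hk : k ≠ 0) (hζ : ζ ^ k = -1) : ‖ζ‖ = 1 := by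
  have h : ‖ζ‖ ^ k = 1 := by rw [← norm_pow, hζ, norm_neg, norm_one]
  exact (pow_eq_one_iff_of_nonneg (norm_nonneg ζ) hk).mp h

/-- `‖i + s‖ = 2^{-1/2}` for `i² = −1`, `s = ±1`, when `‖2‖ = 1/2`: `(i + s)² = 2 s i`. [folklore] -/
theorem norm_sq_root_add_sign (h2 : ‖(2 : F)‖ = 2⁻¹) {i s : F} (hi : i ^ 2 = -1) (hs : s ^ 2 = 1) :
    ‖i + s‖ = (2 : ℝ) ^ (-(1 : ℝ) / 2) := by
  have hs' : s = 1 ∨ s = -1 := sq_eq_one_iff.mp hs  -- needs no char assumption? (field)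
  have hsq : (i + s) ^ 2 = 2 * s * i := by
    have : (i + s) ^ 2 = i ^ 2 + 2 * s * i + s ^ 2 := by ring
    rw [this, hi, hs]; ring
  have hni : ‖i‖ = 1 := norm_eq_one_of_pow_eq_neg_one two_ne_zero hi
  have hns : ‖s‖ = 1 := by rcases hs' with rfl | rfl <;> simp
  have hn2 : ‖i + s‖ ^ 2 = 2⁻¹ := by
    rw [← norm_pow, hsq, norm_mul, norm_mul, h2, hns, hni]; ring
  have hpos : 0 ≤ ‖i + s‖ := norm_nonneg _
  have : ‖i + s‖ = Real.sqrt 2⁻¹ := by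
    rw [← hn2, Real.sqrt_sq hpos]
  rw [this, Real.sqrt_eq_rpow, ← Real.rpow_neg_one 2, ← Real.rpow_mul (by norm_num : (0:ℝ) ≤ 2)]
  norm_num

/-- The unit `3 ∈ (ℤ/4)ˣ`. -/
def u3 : (ZMod 4)ˣ := ⟨3, 3, by decide, by decide⟩
/-- The units `3, 5, 7 ∈ (ℤ/8)ˣ`. -/
def w3 : (ZMod 8)ˣ := ⟨3, 3, by decide, by decide⟩
def w5 : (ZMod 8)ˣ := ⟨5, 5, by decide, by decide⟩
def w7 : (ZMod 8)ˣ := ⟨7, 7, by decide, by decide⟩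

theorem univ_units_zmod_four : (Finset.univ : Finset (ZMod 4)ˣ) = {1, u3} := by decide
theorem univ_units_zmod_eight : (Finset.univ : Finset (ZMod 8)ˣ) = {1, w3, w5, w7} := by decide

/-- **Gauss digit, conductor 4** (`n = 2`): `‖Σ_{a ∈ (ℤ/4)ˣ} f(a)⁻¹ ζ^{−a}‖ = 2⁻¹` for a character `f`
with `f(3) = −1` and `ζ² = −1`, in any normed field with `‖2‖ = 1/2`; the sum is `−2ζ`. [folklore] -/
theorem norm_gaussSum_four (h2 : ‖(2 : F)‖ = 2⁻¹) (ζ : F) (hζ : ζ ^ 2 = -1)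
    (f : (ZMod 4)ˣ →* Fˣ) (hf : ((f u3 : Fˣ) : F) = -1) :
    ‖∑ a : (ZMod 4)ˣ, ((f a : Fˣ) : F)⁻¹ * (ζ ^ (a : ZMod 4).val)⁻¹‖ = (2 : ℝ) ^ (-(2 : ℝ) / 2) := by
  have hζ0 : ζ ≠ 0 := by rintro rfl; norm_num at hζ
  have hne : (1 : (ZMod 4)ˣ) ≠ u3 := by decide
  rw [univ_units_zmod_four, Finset.sum_pair hne, map_one, hf]
  have h1 : ((1 : (ZMod 4)ˣ) : ZMod 4).val = 1 := by decide
  have h3 : ((u3 : (ZMod 4)ˣ) : ZMod 4).val = 3 := by decide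
  rw [h1, h3, Units.val_one]
  have hζ3 : ζ ^ 3 = -ζ := by rw [pow_succ, hζ]; ring
  have hζinv : ζ⁻¹ = -ζ := inv_eq_of_mul_eq_one_right (by rw [mul_neg, ← sq, hζ, neg_neg])
  have hsum : (1 : F)⁻¹ * (ζ ^ 1)⁻¹ + (-1 : F)⁻¹ * (ζ ^ 3)⁻¹ = -2 * ζ := by
    rw [pow_one, hζ3, inv_one, one_mul, inv_neg, inv_neg, hζinv]; ring
  rw [hsum, norm_mul, norm_neg, h2, norm_eq_one_of_pow_eq_neg_one two_ne_zero hζ]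
  norm_num

/-- **Gauss digit, conductor 8** (`n = 3`): `‖Σ_{a ∈ (ℤ/8)ˣ} f(a)⁻¹ ζ^{−a}‖ = 2^{−3/2}` for a character
`f` with `f(5) = −1` and `ζ⁴ = −1`, in any normed field with `‖2‖ = 1/2`; the sum is `−2ζ(ζ² + f(3))`,
`f(3) = ±1`, `‖ζ² ± 1‖ = 2^{−1/2}`. [folklore] -/
theorem norm_gaussSum_eight (h2 : ‖(2 : F)‖ = 2⁻¹) (ζ : F) (hζ : ζ ^ 4 = -1)
    (f : (ZMod 8)ˣ →* Fˣ) (hf : ((f w5 : Fˣ) : F) = -1) :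
    ‖∑ a : (ZMod 8)ˣ, ((f a : Fˣ) : F)⁻¹ * (ζ ^ (a : ZMod 8).val)⁻¹‖ = (2 : ℝ) ^ (-(3 : ℝ) / 2) := by
  have h33 : w3 * w3 = 1 := by decide
  have h35 : w3 * w5 = w7 := by decide
  set s : F := ((f w3 : Fˣ) : F) with hs
  have hs2 : s ^ 2 = 1 := by
    rw [sq, hs, ← Units.val_mul, ← map_mul, h33, map_one, Units.val_one]
  have hsinv : s⁻¹ = s := inv_eq_of_mul_eq_one_right (by rw [← sq, hs2])
  have hf7 : ((f w7 : Fˣ) : F) = -s := by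
    rw [← h35, map_mul, Units.val_mul, hf, ← hs]; ring
  rw [univ_units_zmod_eight, Finset.sum_insert (by decide), Finset.sum_insert (by decide),
    Finset.sum_pair (by decide)]
  have hv1 : ((1 : (ZMod 8)ˣ) : ZMod 8).val = 1 := by decide
  have hv3 : ((w3 : (ZMod 8)ˣ) : ZMod 8).val = 3 := by decide
  have hv5 : ((w5 : (ZMod 8)ˣ) : ZMod 8).val = 5 := by decide
  have hv7 : ((w7 : (ZMod 8)ˣ) : ZMod 8).val = 7 := by decide
  rw [hv1, hv3, hv5, hv7, map_one, Units.val_one, hf, hf7, ← hs]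
  have hζinv : ζ⁻¹ = -ζ ^ 3 :=
    inv_eq_of_mul_eq_one_right (by rw [mul_neg, ← pow_succ', hζ, neg_neg])
  have hζ3inv : (ζ ^ 3)⁻¹ = -ζ :=
    inv_eq_of_mul_eq_one_right (by rw [mul_neg, ← pow_succ, hζ, neg_neg])
  have hζ5 : ζ ^ 5 = -ζ := by rw [pow_succ, hζ]; ring
  have hζ7 : ζ ^ 7 = -ζ ^ 3 := by rw [show (7 : ℕ) = 4 + 3 from rfl, pow_add, hζ]; ring
  have hsum : (1 : F)⁻¹ * (ζ ^ 1)⁻¹ + (s⁻¹ * (ζ ^ 3)⁻¹ + ((-1 : F)⁻¹ * (ζ ^ 5)⁻¹ + (-s)⁻¹ * (ζ ^ 7)⁻¹))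
      = -2 * ζ * (ζ ^ 2 + s) := by
    rw [pow_one, hζ5, hζ7]
    simp only [inv_neg, inv_one]
    rw [hζinv, hζ3inv, hsinv]; ring
  have hi : (ζ ^ 2) ^ 2 = -1 := by rw [← pow_mul]; exact hζ
  rw [hsum, norm_mul, norm_mul, norm_neg, h2, norm_eq_one_of_pow_eq_neg_one (by norm_num) hζ,
    norm_sq_root_add_sign h2 hi hs2, mul_one, ← Real.rpow_neg_one,
    ← Real.rpow_add (by norm_num : (0 : ℝ) < 2)]
  norm_num

/-- **The Gauss digit of H4, `n ∈ {2, 3}` — weakest sufficient form (norm only; no phase, no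
orientation, no `γ₀`-coherence needed).**  For a character `f` of `(ℤ/2ⁿ)ˣ` with `f(1 + 2ⁿ⁻¹) = −1`
(= "exact level `n`", B72) and `ζ^{2^{n−1}} = −1` (= "`ζ` a primitive `2ⁿ`-th root of unity"), in any
normed field with `‖2‖ = 1/2` (e.g. `ℂ₂`): `‖Σ_a f(a)⁻¹ ζ^{−a}‖ = 2^{−n/2}`.  k2-g40's
`stubsig_norm_gaussSumInv_two` is `‖2⁻ⁿ‖ · 1 ·` (this) `= 2ⁿ · 2^{−n/2} = 2^{n/2}` once its summand is
identified with `f(a)⁻¹ ζ'^{−a}` for `f = ι⁻¹ ∘ χ ∘ δ_α`, `ζ' = j_p(γ₀ζ)` — an identification that needs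
`K_v = ℚ₂` (`v` split of degree one) and `w_𝔣 = 1`, binders ABSENT from H4 as typed. [folklore] -/
theorem norm_gaussSum_two_pow (h2 : ‖(2 : F)‖ = 2⁻¹) {n : ℕ} (hn : n = 2 ∨ n = 3) (ζ : F)
    (hζ : ζ ^ 2 ^ (n - 1) = -1) (f : (ZMod (2 ^ n))ˣ →* Fˣ) (γ₀ : (ZMod (2 ^ n))ˣ)
    (hγ₀ : (γ₀ : ZMod (2 ^ n)) = 1 + 2 ^ (n - 1)) (hf : ((f γ₀ : Fˣ) : F) = -1) :
    ‖∑ a : (ZMod (2 ^ n))ˣ, ((f a : Fˣ) : F)⁻¹ * (ζ ^ (a : ZMod (2 ^ n)).val)⁻¹‖ =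
      (2 : ℝ) ^ (-(n : ℝ) / 2) := by
  rcases hn with rfl | rfl
  · have hγ : γ₀ = u3 := Units.ext (by rw [hγ₀]; decide)
    rw [hγ] at hf
    have h := norm_gaussSum_four h2 ζ (by simpa using hζ) f hf
    simpa using h
  · have hγ : γ₀ = w5 := Units.ext (by rw [hγ₀]; decide)
    rw [hγ] at hf
    have h := norm_gaussSum_eight h2 ζ (by simpa using hζ) f hf
    simpa using h

end GaussDigit

/-! ## §D  H3 `exists_unit` — k2-g40's signature, from the fact II.2.4 (i) and two tree lemmas -/

section H3

variable {K : Type} [Field K] [NumberField K]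

open Literature.NumberTheory.ComplexMultiplication.EllipticUnits

/-- **H3 (R223-H) in k2-g40's exact binder shape.**  The lattice `ιK(𝔤)` is a CM lattice
(`isCMLattice_of_mem_iff`), `1` is a primitive `𝔤`-division point of it
(`isPrimitiveDivisionPoint_one_of_mem_iff`), and `(𝔞, 6𝔤) = 1 ⇒ (𝔞, 𝔤) = 1`; so II.2.4 (i)
(`exists_mem_rayClassField_eq_deShalitTheta`) gives `e_n(𝔞) = Θ(1; 𝔤, 𝔞) ∈ ι̂(K(𝔤))`. -/
theorem exists_unit (h24 : DeShalit1987.prop24_i_mem_rayClassField)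
    (hK : IsImaginaryQuadratic K) (ιK : K →+* ℂ) (𝔤 𝔞 : Ideal (𝓞 K)) (h𝔤 : 𝔤 ≠ ⊥) (h𝔤' : 𝔤 ≠ ⊤)
    (h𝔞 : 𝔞 ≠ ⊥) (hcop : IsCoprime 𝔞 (Ideal.span {(6 : 𝓞 K)} * 𝔤)) (L La : PeriodPair) (T : Finset ℂ)
    (hL : ∀ z : ℂ, z ∈ L.lattice ↔ ∃ a ∈ 𝔤, z = ιK (a : K))
    (hLa : La.lattice = idealInvLattice ιK 𝔞 L.lattice) (hT : L.IsLatticeReps La T) :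
    ∃ u : rayClassField K 𝔤, algClosureEmb ιK (u : AlgebraicClosure K) = L.deShalitTheta La T 1 :=
  exists_mem_rayClassField_eq_deShalitTheta h24 hK ιK (isCMLattice_of_mem_iff hL) h𝔤 h𝔤'
    (isPrimitiveDivisionPoint_one_of_mem_iff hL) h𝔞 (IsCoprime.of_mul_right_right hcop) hLa hT

end H3

/-! ## §E  WEAKEST SUFFICIENT junction for LOWER: an UPPER bound on `‖val‖` is all that is consumed -/

section Junction

open WeierstrassCurve
open Literature.NumberTheory.EllipticCurves.Rank1Residual
open Literature.NumberTheory.EllipticCurves.DeShalit1987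
open Literature.NumberTheory.EllipticCurves.GreenbergSelmer
open Literature.NumberTheory.EllipticCurves.IwasawaDual
open Literature.NumberTheory.EllipticCurves.KellerYin2024
open Summit.BirchSwinnertonDyer.BirchSwinnertonDyer.Theorems
open Summit.BirchSwinnertonDyer.BirchSwinnertonDyer.Theorems.PrintCf2
open Summit.BirchSwinnertonDyer.BirchSwinnertonDyer.Theorems.PrintCf2.RubinValueTwoLower

variable {K : Type} [Field K] [NumberField K]
  {d : ℤ} {W : WeierstrassCurve ℚ} [W.IsElliptic] [W.IsGloballyMinimal] {C : VariableChange ℚ}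
  {v vbar : HeightOneSpectrum (𝓞 K)} {ψ : HeckeCharacter K}

/-- **LOWER's junction in its weakest sufficient form: `‖val‖ ≤ 2^{−M/2}` (one-sided).**  The tree's
`lower_two_of_DGal_of_subsetForall_of_katzValueExists` asks Rubin's value in existence form with
`‖val‖ = 2^{−M/2}`; its proof (p694174's `hlow : 2^{−n} ≤ ‖val‖`) reads that equality only as `≤`.
So road A′/B′ owe LOWER only the INEQUALITY «the Katz value at the frame point is AT LEAST as
`2`-divisible as the analytic prediction `M/2`» — every unit / sign / orientation convention of the
junction (J-transport, K3, the phase of `G(χ⁻¹)`) is invisible to LOWER; only valuation LOWER bounds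
of the factors of II.5.2 (4) are.  Same conclusion `M ≤ 2n`. -/
theorem lower_two_of_DGal_of_subsetForall_of_katzValueUpper
    (hD : Deuring_galoisAction_cmPrimaryTorsion_split)
    (hd0 : d ≠ 0) (hsq : Squarefree d) (hd4 : d % 4 ≠ 1) (hC : C • W = cm7.quadraticTwist (d : ℚ)) (hrk : W.analyticRank = 1)
    (hsha : Finite W.sha) (hK : IsImaginaryQuadratic K)
    (hv : ((2 : ℕ) : 𝓞 K) ∈ v.asIdeal) (hvbar : ((2 : ℕ) : 𝓞 K) ∈ vbar.asIdeal) (hne : vbar ≠ v)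
    (ι : PadicAlgCl 2 ≃+* ℂ)
    (hι : ∀ (wi : InfinitePlace K) (k : 𝓞 K), k ∈ v.asIdeal ↔ ‖ι.symm (wi.embedding (k : K))‖ < 1)
    (c : K ≃ₐ[ℚ] K) (hc : c ≠ 1) (hψ : ψ.HasInfinityType (fun _ ↦ 1) (fun _ ↦ 0))
    (hL : ∀ s : ℂ, 3 / 2 < s.re → heckeLFunction ψ s = W.LSeries s)
    {κ₁ κ₂ : ZpExtension K 2} {γ₁ γ₂ : absoluteGaloisGroup K} (hpair : ZpExtension.IsTopGeneratorPair κ₁ κ₂ γ₁ γ₂)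
    (hκ₂ : κ₂.IsUnramifiedOutside vbar)
    {θ : FramedGaloisRep K (padicCoeffIntegers (∅ : Set (PadicAlgCl 2))) 1} {θK ρ : HeckeCharacter K}
    {r : FramedGaloisRep K (PadicAlgCl 2) 1}
    (hθ2 : ∀ σ : absoluteGaloisGroup K, θ σ ^ 2 = 1) (hθθK : IsHeckeCharOf ι θ θK) (hρr : IsPAdicAvatarOf ι ρ r)
    (hrpair : FactorsThroughPair κ₁ κ₂ r) (hρ : θK⁻¹ * ρ = (HeckeCharacter.galConj c ψ)⁻¹)
    (Sθ : Finset (HeightOneSpectrum (𝓞 K)))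
    (hMCall : ∀ (Ω δ : ℂ) (Ωp : (unrIntegers 2)ˣ) (G₂ : PowerSeries (PowerSeries (PadicComplexInt 2))),
      Ω ≠ 0 → (δ ^ 2 = (NumberField.discr K : ℂ) ∨ δ ^ 2 = -(NumberField.discr K : ℂ)) →
      IsKatzMeasure₂ ι v vbar Sθ κ₁ κ₂ γ₁⁻¹ γ₂⁻¹ θK⁻¹ Ω δ ((Ωp : unrIntegers 2) : ℂ_[2]) G₂ →
      ∀ D₂ : DualData₂ κ₁ κ₂ (charModule (∅ : Set (PadicAlgCl 2)) θ) vbar γ₁ γ₂,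
        Module.Finite (IwasawaAlgebra₂ 2) D₂.X ∧ Module.IsTorsion (IwasawaAlgebra₂ 2) D₂.X ∧
        ∀ (J : ℤ_[2] →+* PadicComplexInt 2),
          (∀ x : ℤ_[2], ((J x : PadicComplexInt 2) : ℂ_[2]) = ((x : ℚ_[2]) : ℂ_[2])) →
          (Module.charIdeal (IwasawaAlgebra₂ 2) D₂.X).map (PowerSeries.map (PowerSeries.map J)) ≤ Ideal.span {G₂})
    {M : ℤ}
    (hRle : ∃ (Ω δ : ℂ) (Ωp : (unrIntegers 2)ˣ) (G₂ : PowerSeries (PowerSeries (PadicComplexInt 2))),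
      Ω ≠ 0 ∧ (δ ^ 2 = (NumberField.discr K : ℂ) ∨ δ ^ 2 = -(NumberField.discr K : ℂ)) ∧
      IsKatzMeasure₂ ι v vbar Sθ κ₁ κ₂ γ₁⁻¹ γ₂⁻¹ θK⁻¹ Ω δ ((Ωp : unrIntegers 2) : ℂ_[2]) G₂ ∧
      ∃ val : ℂ_[2], IntSeries.HasValueAt₂ G₂ (avatarValueAt r γ₁⁻¹ - 1) (avatarValueAt r γ₂⁻¹ - 1) val ∧
        ‖val‖ ≤ (2 : ℝ) ^ (-(M : ℝ) / 2))
    (P : W.toAffine.Point) (c₀ : ℕ) (ℓ : ℤ) (hP : ¬ IsOfFinAddOrder P)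
    (hgen : ∀ R : W.toAffine.Point, ∃ (k : ℤ) (T : W.toAffine.Point), IsOfFinAddOrder T ∧ R = k • P + T)
    (hc₀ : c₀ ≠ 0) (hker : (W.baseChange ℚ_[2]).IsInReductionKernel (c₀ • W.toPadicPoint 2 P))
    (hlog : ‖(W.baseChange ℚ_[2]).padicLogPoint (c₀ • W.toPadicPoint 2 P) / (c₀ : ℚ_[2])‖ = (2 : ℝ) ^ (-ℓ)) :
    ∃ (π : (W.baseChange K).endRing) (_ : (π : AddMonoid.End (W.baseChange K).geomPoints) * π = π - 2)
      (r₀ : ℤ_[2]) (_ : r₀ * r₀ = r₀ - 2)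
      (_ : ∀ τ ∈ GreenbergSelmer.inertia v, ∀ x : ↥((W.baseChange K).endEigenPrimaryTorsion 2 π r₀), τ • x = x ∨ τ • x = -x)
      (D : GreenbergVatsal2000.DatumDualData κ₂ γ₂ ↥((W.baseChange K).endEigenPrimaryTorsion 2 π r₀)
        (Castella2018.AcSelmer.bdpData ↥((W.baseChange K).endEigenPrimaryTorsion 2 π r₀) 2 vbar) ∅) (n : ℕ) (H : IwasawaAlgebra 2),
      Module.Finite (IwasawaAlgebra 2) D.X ∧ Module.IsTorsion (IwasawaAlgebra 2) D.X ∧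
      Module.charIdeal (IwasawaAlgebra 2) D.X = Ideal.span {H} ∧ PowerSeries.constantCoeff H ≠ 0 ∧
      (PowerSeries.constantCoeff H).valuation = n ∧ M ≤ 2 * (n : ℤ) := by
  obtain ⟨Ω, δ, Ωp, G₂, hΩ, hδ, hG₂, val, hval, hnorm⟩ := hRle
  have hMC := hMCall Ω δ Ωp G₂ hΩ hδ hG₂
  obtain ⟨π, hrel, r₀, hr₀, hpin, D, n, H, hfg, hX, hH, hH0, hn, hlow⟩ := restrictedMainConj_two_lower_of_DGal hD hd0 hsq hd4 hC hrk hsha hK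
    hv hvbar hne ι hι c hc hψ hL hpair hκ₂ hθ2 hθθK hρr hrpair hρ hMC P c₀ ℓ hP hgen hc₀ hker hlog
  refine ⟨π, hrel, r₀, hr₀, hpin, D, n, H, hfg, hX, hH, hH0, hn, ?_⟩
  have h : (2 : ℝ) ^ (-(n : ℤ)) ≤ (2 : ℝ) ^ (-(M : ℝ) / 2) := (hlow val hval).trans hnorm
  have h' : (2 : ℝ) ^ ((-(n : ℤ) : ℤ) : ℝ) ≤ (2 : ℝ) ^ (-(M : ℝ) / 2) := by rwa [Real.rpow_intCast]
  have h'' := (Real.rpow_le_rpow_left_iff (by norm_num : (1 : ℝ) < 2)).mp h'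
  have h3 : (-(n : ℤ) : ℝ) ≤ -(M : ℝ) / 2 := by exact_mod_cast h''
  have h4 : (M : ℝ) ≤ 2 * (n : ℝ) := by push_cast at h3; linarith
  exact_mod_cast h4

omit [NumberField K] in
/-- …and the tree's existence-form consumer is the special case `‖val‖ = 2^{−M/2}` (`le_of_eq`). -/
theorem katzValueExists_imp_upper {G₂ : PowerSeries (PowerSeries (PadicComplexInt 2))}
    {r : FramedGaloisRep K (PadicAlgCl 2) 1} {γ₁ γ₂ : absoluteGaloisGroup K} {M : ℤ}
    (h : ∃ val : ℂ_[2], IntSeries.HasValueAt₂ G₂ (avatarValueAt r γ₁⁻¹ - 1) (avatarValueAt r γ₂⁻¹ - 1) val ∧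
        ‖val‖ = (2 : ℝ) ^ (-(M : ℝ) / 2)) :
    ∃ val : ℂ_[2], IntSeries.HasValueAt₂ G₂ (avatarValueAt r γ₁⁻¹ - 1) (avatarValueAt r γ₂⁻¹ - 1) val ∧
        ‖val‖ ≤ (2 : ℝ) ^ (-(M : ℝ) / 2) := by
  obtain ⟨val, hval, hnorm⟩ := h
  exact ⟨val, hval, hnorm.le⟩

end Junction

/-! ## §F  JUNCTION (B74) — k2-g40's `stubsig_` texts VERBATIM, closed by §A / §B / §D

The three statements below are copied token-for-token from k2-g40's sketch
(`STUB_IDEAS_stub_heegnerIndexLowerAtTwo_2_g40.lean` ll. 251–284, namespace `…CosetValuesK2G40`,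
same `variable` line); only `:= by sorry` is replaced by a one-term proof. -/

namespace JunctionK2G40

variable {p : ℕ} [Fact p.Prime] {K : Type} [Field K] [NumberField K]

open Literature.NumberTheory.ComplexMultiplication.EllipticUnits

/-- H1 (S, CFT/compactness): a lift `γ₀ ∈ Γ_K` of the compatible Artin symbols `(𝔭ⁿ, K(𝔣v̄^m)/K)`,
`m ≥ 0`, exists — so the `γ₀`-binder of `IsCosetValues` is never vacuous.  [k2-g40 VERBATIM;
PROVED by §B `exists_frobLift` — one absolute Frobenius, no compactness] -/
theorem stubsig_exists_frobLift (𝔣 : Ideal (𝓞 K)) (h𝔣 : 𝔣 ≠ ⊥) (v vbar : HeightOneSpectrum (𝓞 K))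
    (hv : IsCoprime 𝔣 v.asIdeal) (hne : vbar ≠ v) (n : ℕ) :
    ∃ γ₀ : absoluteGaloisGroup K, ∀ m : ℕ,
      absRestrictNormalHom (rayClassField K (𝔣 * vbar.asIdeal ^ m)) γ₀ =
        artinSymbol (galFrob K (rayClassField K (𝔣 * vbar.asIdeal ^ m))) (v.asIdeal ^ n) :=
  exists_frobLift 𝔣 h𝔣 v vbar hv hne n

omit [Fact p.Prime] in
/-- H2 (S, CFT): `rayKer K p S ≤ ker(Γ_K → Gal(K(𝔤)/K))` when `supp 𝔤 ⊆ S ∪ {v, v̄}` — whence the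
tower-continuity hypothesis of `IsCosetValues` is DISCHARGED for the fact's `𝒰` (`⋂ U_n ⊆ rayKer`,
`U_n` open, `SubgroupTower.exists_subset_of_isOpen`; cf. `isTowerContinuous_avatarValueAt`).
[k2-g40 VERBATIM; PROVED by §A `rayKer_le_ker` — corollary of the tree's RayClassTower §2] -/
theorem stubsig_rayKer_le_ker (S : Finset (HeightOneSpectrum (𝓞 K))) (v vbar : HeightOneSpectrum (𝓞 K))
    (hv : ((p : ℕ) : 𝓞 K) ∈ v.asIdeal) (hvbar : ((p : ℕ) : 𝓞 K) ∈ vbar.asIdeal)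
    (𝔤 : Ideal (𝓞 K)) (h𝔤 : 𝔤 ≠ ⊥)
    (hsupp : ∀ w : HeightOneSpectrum (𝓞 K), w.asIdeal ∣ 𝔤 → w ∈ S ∨ w = v ∨ w = vbar) :
    DeShalit1987.rayKer K p S ≤ (absRestrictNormalHom (rayClassField K 𝔤)).ker :=
  rayKer_le_ker S v vbar hv hvbar 𝔤 h𝔤 hsupp

/-- H3 (XS, from II.2.4 (i) = `DeShalit1987.prop24_i_mem_rayClassField`): the unit binder is never
vacuous — `e_n(𝔞) = Θ(1; 𝔤, 𝔞)` lies in `ι̂(K(𝔤))` (lattice `ιK(𝔤)` is a CM lattice and `1` is a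
primitive `𝔤`-division point of it; `exists_mem_rayClassField_eq_deShalitTheta`).
[k2-g40 VERBATIM; PROVED by §D `exists_unit`] -/
theorem stubsig_exists_unit (h24 : DeShalit1987.prop24_i_mem_rayClassField)
    (hK : IsImaginaryQuadratic K) (ιK : K →+* ℂ) (𝔤 𝔞 : Ideal (𝓞 K)) (h𝔤 : 𝔤 ≠ ⊥) (h𝔤' : 𝔤 ≠ ⊤)
    (h𝔞 : 𝔞 ≠ ⊥) (hcop : IsCoprime 𝔞 (Ideal.span {(6 : 𝓞 K)} * 𝔤)) (L La : PeriodPair) (T : Finset ℂ)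
    (hL : ∀ z : ℂ, z ∈ L.lattice ↔ ∃ a ∈ 𝔤, z = ιK (a : K))
    (hLa : La.lattice = idealInvLattice ιK 𝔞 L.lattice) (hT : L.IsLatticeReps La T) :
    ∃ u : rayClassField K 𝔤, algClosureEmb ιK (u : AlgebraicClosure K) = L.deShalitTheta La T 1 :=
  exists_unit h24 hK ιK 𝔤 𝔞 h𝔤 h𝔤' h𝔞 hcop L La T hL hLa hT

end JunctionK2G40

end Summit.BirchSwinnertonDyer.BirchSwinnertonDyer.Cruxes.SplitBadTwoLowerHalfOfFacts.WeakStrongK1G40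

end
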